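import Literature.MathematicalPhysics.QuantumLattice.HubbardLiebBasis
import Literature.MathematicalPhysics.QuantumLattice.TokenSliding
import Literature.MathematicalPhysics.QuantumLattice.SpinReflectionPositivity
import HarnessLib

/-!
# The half-filled `S^z = 0` sector of the Hubbard model in Lieb's coordinates

Trunk T-QLATTICE, family `hubbard`. Continues `HubbardLiebBasis` (Lieb, PRL 62 (1989) 1201,
proofs of Theorems 1–2; reprint in Montorsi (ed.), *The Hubbard Model*, pp. 111–119).

* Restriction to `n`-subsets (`Config Λ n`, `liebK`, `liebL` of `HubbardLiebConfig`; `extMatrix`,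
  `resMatrix = Matrix.submatrix` along `Subtype.val`; `toFockN A n W = Φ(W)`):
  `Φ` is an injective isometry onto the Fock vectors with `N_↑ = n` and `n` down-spin **holes**
  (`star_toFockN_dotProduct_toFockN`, `toFockN_resMatrix_ofFock`), and
  `H Φ(W) = Φ(𝓗 W) + U n Φ(W)` (`hamiltonian_mulVec_toFockN`) where
  `𝓗 = Literature.Hubbard.liebOp (liebK G t n) (rdiag ∘ occInd n) (-U)` is Lieb's operator of
  `LiebSpinReflection` with the **attractive** coupling `-U` (`liebK G t n` real symmetric by
  `LiebThm1.liebK_conjTranspose`/`liebK_transpose`; `rdiag (occInd n x) = liebL n x`, `rdiag_occInd`).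
* The hypotheses of `SpinReflectionPositivity.exists_posDef_groundState_unique`: the occupations
  separate `n`-subsets (`occInd_separating`), and the graph of `K_n` is connected by
  `TokenSliding.exists_slide_out` and `LiebThm1.hoppingMatrix_hop_ne_zero` (`liebK_connected`); hence
  `exists_posDef_groundState`: for
  `t ≠ 0`, `U > 0`, `G` connected, the lowest eigenvalue of `𝓗` is nondegenerate with a positive
  definite eigenmatrix `W₀`.
* The reference state `refState A n J = Φ(D)`, `D` diagonal with `D_αα = (n-p)!(J+p)!`,
  `p = #(α ∩ A)` (its values carry the Marshall sign times the flip-invariant self-sign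
  `pairSign α α`, `pairSign_mul_kappaSign_diag`, `pairSign_self_flip`): for `|Λ| = 2n`, `|A| + J = n`
  it satisfies `S² Ξ = J(J+1) Ξ`
  (`spinSq_mulVec_refState`, an explicit Clebsch–Gordan / Marshall-sign computation reduced to the
  combinatorial identity `flip_sum_eq`) and `⟨Ξ, Φ(W)⟩ = Σ_α D_αα W_αα ≠ 0` for positive definite
  `W` (`refState_overlap_ne_zero`). In Lieb's paper the value of the ground-state spin is obtained
  instead by continuity in `U` and the Lieb–Mattis theorem for the Heisenberg model; the overlap
  argument used here is the one Lieb uses for Theorem 1(a) ("`W_αα > 0` for some `α` … nonzero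
  projection onto `S = 0`"), with the spin-`J` reference state replacing his `S = 0` states.
  These statements are folklore.
-/

noncomputable section

namespace Literature.MathematicalPhysics.QuantumLattice.LiebTwo

open Matrix Finset LiebThm1
open scoped ComplexOrder

attribute [local simp] Literature.MathematicalPhysics.QuantumLattice.star_jwSign

section SectorGlue

variable {Λ : Type*} [LinearOrder Λ] [Fintype Λ]

/-- Extension by zero of a coefficient matrix on `n`-subsets to all subsets. [folklore] -/
def extMatrix (n : ℕ) (W : Matrix (Config Λ n) (Config Λ n) ℂ) : Matrix (Finset Λ) (Finset Λ) ℂ :=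
  fun a b => if h : a.card = n ∧ b.card = n then W ⟨a, h.1⟩ ⟨b, h.2⟩ else 0

/-- Restriction of a matrix on all subsets to `n`-subsets: the `Matrix.submatrix` along
`Subtype.val` (`resMatrix_eq_submatrix`); e.g. `resMatrix n (hoppingMatrix G t)` is definitionally
Lieb's `liebK G t n` (`hoppingMatrix_submatrix` of `HubbardLiebBasis`). [folklore] -/
def resMatrix (n : ℕ) (M : Matrix (Finset Λ) (Finset Λ) ℂ) : Matrix (Config Λ n) (Config Λ n) ℂ :=
  fun α β => M α.1 β.1

omit [LinearOrder Λ] [Fintype Λ] in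
/-- `resMatrix` is `Matrix.submatrix` along the inclusion of `n`-subsets. [folklore] -/
theorem resMatrix_eq_submatrix (n : ℕ) (M : Matrix (Finset Λ) (Finset Λ) ℂ) :
    resMatrix n M = M.submatrix Subtype.val Subtype.val := rfl

omit [LinearOrder Λ] [Fintype Λ] in
/-- `extMatrix` on `n`-subsets. [folklore] -/
@[simp] theorem extMatrix_apply_coe (n : ℕ) (W : Matrix (Config Λ n) (Config Λ n) ℂ) (α β : Config Λ n) :
    extMatrix n W α.1 β.1 = W α β := by
  simp [extMatrix, α.2, β.2]

omit [LinearOrder Λ] [Fintype Λ] in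
/-- `extMatrix` vanishes off `n`-subsets. [folklore] -/
theorem extMatrix_apply_of_not (n : ℕ) (W : Matrix (Config Λ n) (Config Λ n) ℂ) {a b : Finset Λ}
    (h : ¬ (a.card = n ∧ b.card = n)) : extMatrix n W a b = 0 := by
  simp [extMatrix, h]

omit [LinearOrder Λ] [Fintype Λ] in
/-- `res ∘ ext = id`. [folklore] -/
@[simp] theorem resMatrix_extMatrix (n : ℕ) (W : Matrix (Config Λ n) (Config Λ n) ℂ) :
    resMatrix n (extMatrix n W) = W := by
  ext α β; simp [resMatrix]

omit [LinearOrder Λ] [Fintype Λ] in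
/-- `ext ∘ res = id` on matrices supported on `n`-subsets. [folklore] -/
theorem extMatrix_resMatrix (n : ℕ) {M : Matrix (Finset Λ) (Finset Λ) ℂ}
    (hM : ∀ a b, M a b ≠ 0 → a.card = n ∧ b.card = n) : extMatrix n (resMatrix n M) = M := by
  ext a b
  by_cases h : a.card = n ∧ b.card = n
  · simp [extMatrix, resMatrix, h]
  · rw [extMatrix_apply_of_not n _ h]
    by_contra h'
    exact h (hM a b (Ne.symm h'))

omit [LinearOrder Λ] [Fintype Λ] in
/-- `extMatrix` is additive. [folklore] -/
theorem extMatrix_add (n : ℕ) (W W' : Matrix (Config Λ n) (Config Λ n) ℂ) :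
    extMatrix n (W + W') = extMatrix n W + extMatrix n W' := by
  ext a b; by_cases h : a.card = n ∧ b.card = n <;> simp [extMatrix, h]

omit [LinearOrder Λ] [Fintype Λ] in
/-- `extMatrix` respects subtraction. [folklore] -/
theorem extMatrix_sub (n : ℕ) (W W' : Matrix (Config Λ n) (Config Λ n) ℂ) :
    extMatrix n (W - W') = extMatrix n W - extMatrix n W' := by
  ext a b; by_cases h : a.card = n ∧ b.card = n <;> simp [extMatrix, h]

omit [LinearOrder Λ] [Fintype Λ] in
/-- `extMatrix` is homogeneous. [folklore] -/
theorem extMatrix_smul (n : ℕ) (c : ℂ) (W : Matrix (Config Λ n) (Config Λ n) ℂ) :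
    extMatrix n (c • W) = c • extMatrix n W := by
  ext a b; by_cases h : a.card = n ∧ b.card = n <;> simp [extMatrix, h]

omit [LinearOrder Λ] [Fintype Λ] in
/-- `extMatrix` of a sum. [folklore] -/
theorem extMatrix_sum (n : ℕ) {κ : Type*} (S : Finset κ) (W : κ → Matrix (Config Λ n) (Config Λ n) ℂ) :
    extMatrix n (∑ k ∈ S, W k) = ∑ k ∈ S, extMatrix n (W k) := by
  ext a b
  rw [Matrix.sum_apply]
  by_cases h : a.card = n ∧ b.card = n
  · simp [extMatrix, h, Matrix.sum_apply]
  · simp [extMatrix, h]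

variable (G : SimpleGraph Λ) [DecidableRel G.Adj]

/-- `K ext(W) = ext(K_n W)`: the hopping matrix preserves the particle number. [folklore] -/
theorem hoppingMatrix_mul_extMatrix (t : ℝ) (n : ℕ) (W : Matrix (Config Λ n) (Config Λ n) ℂ) :
    hoppingMatrix G t * extMatrix n W = extMatrix n (liebK G t n * W) := by
  ext a b
  rw [Matrix.mul_apply]
  by_cases h : a.card = n ∧ b.card = n
  · have hrhs : extMatrix n (liebK G t n * W) a b = (liebK G t n * W) ⟨a, h.1⟩ ⟨b, h.2⟩ :=
      extMatrix_apply_coe n _ ⟨a, h.1⟩ ⟨b, h.2⟩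
    rw [hrhs, Matrix.mul_apply, ← sum_config_eq_sum n]
    · refine Finset.sum_congr rfl fun γ _ => ?_
      rw [← extMatrix_apply_coe n W γ ⟨b, h.2⟩]; rfl
    · intro c hc
      rw [extMatrix_apply_of_not n W (fun h' => hc h'.1), mul_zero]
  · rw [extMatrix_apply_of_not n _ h]
    refine Finset.sum_eq_zero fun c _ => ?_
    by_cases hc : c.card = n ∧ b.card = n
    · have hK : hoppingMatrix G t a c = 0 := by
        by_contra hne
        exact h ⟨(hoppingMatrix_apply_ne_zero G hne).trans hc.1, hc.2⟩
      rw [hK, zero_mul]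
    · rw [extMatrix_apply_of_not n W hc, mul_zero]

/-- `ext(W) K = ext(W K_n)`. [folklore] -/
theorem extMatrix_mul_hoppingMatrix (t : ℝ) (n : ℕ) (W : Matrix (Config Λ n) (Config Λ n) ℂ) :
    extMatrix n W * hoppingMatrix G t = extMatrix n (W * liebK G t n) := by
  ext a b
  rw [Matrix.mul_apply]
  by_cases h : a.card = n ∧ b.card = n
  · have hrhs : extMatrix n (W * liebK G t n) a b = (W * liebK G t n) ⟨a, h.1⟩ ⟨b, h.2⟩ :=
      extMatrix_apply_coe n _ ⟨a, h.1⟩ ⟨b, h.2⟩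
    rw [hrhs, Matrix.mul_apply, ← sum_config_eq_sum n]
    · refine Finset.sum_congr rfl fun γ _ => ?_
      rw [← extMatrix_apply_coe n W ⟨a, h.1⟩ γ]; rfl
    · intro c hc
      rw [extMatrix_apply_of_not n W (fun h' => hc h'.2), zero_mul]
  · rw [extMatrix_apply_of_not n _ h]
    refine Finset.sum_eq_zero fun c _ => ?_
    by_cases hc : a.card = n ∧ c.card = n
    · have hK : hoppingMatrix G t c b = 0 := by
        by_contra hne
        exact h ⟨hc.1, (hoppingMatrix_apply_ne_zero G hne).symm.trans hc.2⟩
      rw [hK, mul_zero]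
    · rw [extMatrix_apply_of_not n W hc, zero_mul]

/-- Lieb's site-occupation matrices `(L_x)_αβ = ⟨ψ^β|n_x|ψ^α⟩ = δ_αβ [x ∈ α]` as real diagonals. [cite: LiebPRL1989, proof of Theorem 1] -/
def occInd (n : ℕ) (x : Λ) (α : Config Λ n) : ℝ := if x ∈ α.1 then 1 else 0

omit [Fintype Λ] in
/-- Bridge to `HubbardLiebConfig`: `rdiag (occInd n x)` is Lieb's occupation matrix `liebL n x`. [folklore] -/
theorem rdiag_occInd (n : ℕ) (x : Λ) :
    Literature.MathematicalPhysics.QuantumLattice.SpinReflection.rdiag (occInd n x) = (liebL n x : Matrix (Config Λ n) (Config Λ n) ℂ) := by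
  rw [Literature.MathematicalPhysics.QuantumLattice.SpinReflection.rdiag, liebL]
  congr 1; funext α
  by_cases h : x ∈ α.1 <;> simp [occInd, h]

/-- `n_x ext(W) n_x = ext(L_x W L_x)`. [folklore] -/
theorem numberAt_mul_extMatrix_mul_numberAt (n : ℕ) (x : Λ) (W : Matrix (Config Λ n) (Config Λ n) ℂ) :
    Literature.MathematicalPhysics.QuantumLattice.numberAt x * extMatrix n W * Literature.MathematicalPhysics.QuantumLattice.numberAt x =
      extMatrix n (Literature.MathematicalPhysics.QuantumLattice.SpinReflection.rdiag (occInd n x) * W *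
        Literature.MathematicalPhysics.QuantumLattice.SpinReflection.rdiag (occInd n x)) := by
  ext a b
  simp only [Literature.MathematicalPhysics.QuantumLattice.numberAt_eq_diagonal, mul_diagonal, diagonal_mul]
  by_cases h : a.card = n ∧ b.card = n
  · have hrhs : ∀ V : Matrix (Config Λ n) (Config Λ n) ℂ, extMatrix n V a b = V ⟨a, h.1⟩ ⟨b, h.2⟩ :=
      fun V => extMatrix_apply_coe n V ⟨a, h.1⟩ ⟨b, h.2⟩
    rw [hrhs, hrhs]
    simp only [Literature.MathematicalPhysics.QuantumLattice.SpinReflection.rdiag, mul_diagonal, diagonal_mul, occInd]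
    split_ifs <;> simp
  · rw [extMatrix_apply_of_not n _ h, extMatrix_apply_of_not n _ h]; simp

/-- `N ext(W) = n ext(W)`. [folklore] -/
theorem totalNumberOp_mul_extMatrix (n : ℕ) (W : Matrix (Config Λ n) (Config Λ n) ℂ) :
    (Literature.MathematicalPhysics.QuantumLattice.totalNumberOp : Matrix (Finset Λ) (Finset Λ) ℂ) * extMatrix n W = (n : ℂ) • extMatrix n W := by
  ext a b
  rw [Literature.MathematicalPhysics.QuantumLattice.totalNumberOp_eq_diagonal, diagonal_mul, Matrix.smul_apply, smul_eq_mul]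
  by_cases h : a.card = n ∧ b.card = n
  · rw [h.1]
  · rw [extMatrix_apply_of_not n _ h, mul_zero, mul_zero]

/-- The intertwining operator on the sector is Lieb's operator `Literature.MathematicalPhysics.QuantumLattice.liebOp` with `K = K_n`,
`L_x = rdiag (occInd n x)` (`= liebL n x`) and **attractive** coupling `-U`, plus the constant
`U n`. [cite: LiebPRL1989, eq. (4)] -/
theorem liebOperator_extMatrix (t U : ℝ) (n : ℕ) (W : Matrix (Config Λ n) (Config Λ n) ℂ) :
    liebOperator G t U (extMatrix n W) =
      extMatrix n (Literature.MathematicalPhysics.QuantumLattice.liebOp (liebK G t n) (fun x => Literature.MathematicalPhysics.QuantumLattice.SpinReflection.rdiag (occInd n x)) (-U) W) +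
        ((U : ℂ) * n) • extMatrix n W := by
  rw [liebOperator, Literature.MathematicalPhysics.QuantumLattice.liebOp, Literature.MathematicalPhysics.QuantumLattice.liebOp, hoppingMatrix_mul_extMatrix, extMatrix_mul_hoppingMatrix,
    totalNumberOp_mul_extMatrix, extMatrix_add, extMatrix_add, extMatrix_smul, extMatrix_sum, smul_smul]
  simp only [numberAt_mul_extMatrix_mul_numberAt]

/-- Lieb's change of basis restricted to the sector `N_↑ = n`, `N_↓ = |Λ| - n` (holes `n`):
`Φ W = ψ_{ext W}`. [cite: LiebPRL1989, proof of Theorem 2] -/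
def toFockN (A : Finset Λ) (n : ℕ) (W : Matrix (Config Λ n) (Config Λ n) ℂ) : Fock (Orb Λ) :=
  toFock A (extMatrix n W)

/-- **The Hubbard Hamiltonian in Lieb's coordinates on the sector**:
`H Φ(W) = Φ(K_n W + W K_n - U Σ_x L_x W L_x) + U n Φ(W)`. [cite: LiebPRL1989, proof of Theorem 2, eqs. (4)–(5)] -/
theorem hamiltonian_mulVec_toFockN (A : Finset Λ) (hA : ∀ x y : Λ, G.Adj x y → (x ∈ A ↔ y ∉ A))
    (t U : ℝ) (n : ℕ) (W : Matrix (Config Λ n) (Config Λ n) ℂ) :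
    hamiltonian G t U *ᵥ toFockN A n W =
      toFockN A n (Literature.MathematicalPhysics.QuantumLattice.liebOp (liebK G t n) (fun x => Literature.MathematicalPhysics.QuantumLattice.SpinReflection.rdiag (occInd n x)) (-U) W) +
        ((U : ℂ) * n) • toFockN A n W := by
  rw [toFockN, hamiltonian_mulVec_toFock G A hA, liebOperator_extMatrix, toFock_add, toFock_smul]; rfl

/-- `Φ` is additive. [folklore] -/
theorem toFockN_add (A : Finset Λ) (n : ℕ) (W W' : Matrix (Config Λ n) (Config Λ n) ℂ) :
    toFockN A n (W + W') = toFockN A n W + toFockN A n W' := by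
  rw [toFockN, extMatrix_add, toFock_add]; rfl

/-- `Φ` is homogeneous. [folklore] -/
theorem toFockN_smul (A : Finset Λ) (n : ℕ) (c : ℂ) (W : Matrix (Config Λ n) (Config Λ n) ℂ) :
    toFockN A n (c • W) = c • toFockN A n W := by
  rw [toFockN, extMatrix_smul, toFock_smul]; rfl

/-- `Φ` respects subtraction. [folklore] -/
theorem toFockN_sub (A : Finset Λ) (n : ℕ) (W W' : Matrix (Config Λ n) (Config Λ n) ℂ) :
    toFockN A n (W - W') = toFockN A n W - toFockN A n W' := by
  rw [toFockN, extMatrix_sub, toFock_sub]; rfl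

/-- `Φ` is injective. [folklore] -/
theorem toFockN_injective (A : Finset Λ) (n : ℕ) : Function.Injective (toFockN (Λ := Λ) A n) := by
  intro W W' h
  have h' := toFock_injective A h
  rw [← resMatrix_extMatrix n W, h', resMatrix_extMatrix]

/-- **`Φ` is an isometry** for the Hilbert–Schmidt inner product: `⟨Φ W, Φ W'⟩ = ⟨W, W'⟩_HS = Tr W†W'`.
[cite: LiebPRL1989, eq. (3)] -/
theorem star_toFockN_dotProduct_toFockN (A : Finset Λ) (n : ℕ) (W W' : Matrix (Config Λ n) (Config Λ n) ℂ) :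
    star (toFockN A n W) ⬝ᵥ toFockN A n W' = hsInner W W' := by
  rw [toFockN, toFockN, star_toFock_dotProduct_toFock, hsInner_apply, hsInner_apply, ← sum_config_eq_sum n]
  · refine Finset.sum_congr rfl fun α _ => ?_
    rw [← sum_config_eq_sum n]
    · simp
    · intro c hc
      rw [extMatrix_apply_of_not n W' (fun h => hc h.2), mul_zero]
  · intro c hc
    refine Finset.sum_eq_zero fun b _ => ?_
    rw [extMatrix_apply_of_not n W' (fun h => hc h.1), mul_zero]

/-- Support of `Φ W`: `N_↑ = n` and (holes) `|Λ| - N_↓ = n`. [folklore] -/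
theorem toFockN_apply_ne_zero (A : Finset Λ) (n : ℕ) (W : Matrix (Config Λ n) (Config Λ n) ℂ)
    {s : Finset (Orb Λ)} (h : toFockN A n W s ≠ 0) : (upPart s).card = n ∧ (downPart s)ᶜ.card = n := by
  rw [toFockN, toFock] at h
  by_contra hc
  exact h (by rw [extMatrix_apply_of_not n W hc, mul_zero])

/-- **`Φ` is onto the sector**: a Fock vector supported on `N_↑ = n`, `|Λ| - N_↓ = n` is `Φ` of the
restriction of its coefficient matrix. [cite: LiebPRL1989, proof of Theorem 1] -/
theorem toFockN_resMatrix_ofFock (A : Finset Λ) (n : ℕ) {ψ : Fock (Orb Λ)}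
    (hψ : ∀ s, ψ s ≠ 0 → (upPart s).card = n ∧ (downPart s)ᶜ.card = n) :
    toFockN A n (resMatrix n (ofFock A ψ)) = ψ := by
  rw [toFockN, extMatrix_resMatrix n, toFock_ofFock]
  intro a b hab
  rw [ofFock] at hab
  have h := hψ _ (right_ne_zero_of_mul hab)
  rwa [upPart_pairSet, downPart_pairSet, compl_compl] at h

/-- The `L_x` separate `n`-subsets. [folklore] -/
theorem occInd_separating (n : ℕ) (α β : Config Λ n) (h : α ≠ β) : ∃ x : Λ, occInd n x α ≠ occInd n x β := by
  by_contra hc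
  push Not at hc
  apply h
  apply Subtype.ext
  ext x
  have hx := hc x
  unfold occInd at hx
  by_cases h1 : x ∈ α.1 <;> by_cases h2 : x ∈ β.1 <;> simp [h1, h2] at hx ⊢

/-- The graph of `K_n` on `n`-subsets is connected (token sliding). [cite: LiebPRL1989, proof of Theorem 1(b)] -/
theorem liebK_connected (hG : G.Connected) {t : ℝ} (ht : t ≠ 0) (n : ℕ) (S : Set (Config Λ n))
    (ha : ∃ α, α ∈ S) (hb : ∃ β, β ∉ S) : ∃ α ∈ S, ∃ β ∉ S, liebK G t n α β ≠ 0 := by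
  classical
  set S' : Set (Finset Λ) := {a | ∃ h : a.card = n, (⟨a, h⟩ : Config Λ n) ∈ S} with hS'
  obtain ⟨α, hα⟩ := ha
  obtain ⟨β, hβ⟩ := hb
  have ha' : ∃ a ∈ S', a.card = n := ⟨α.1, ⟨α.2, by simpa using hα⟩, α.2⟩
  have hb' : ∃ b ∉ S', b.card = n := ⟨β.1, by rintro ⟨h, h'⟩; exact hβ (by simpa using h'), β.2⟩
  obtain ⟨a, haS, han, x, hx, y, hy, hxy, hout⟩ := exists_slide_out G hG n S' ha' hb'
  obtain ⟨h1, h2⟩ := haS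
  have hcard : (insert y (a.erase x)).card = n := by rw [card_slide hx hy, han]
  refine ⟨⟨a, han⟩, h2, ⟨insert y (a.erase x), hcard⟩, fun h => hout ⟨hcard, h⟩, ?_⟩
  show hoppingMatrix G t a (insert y (a.erase x)) ≠ 0
  rw [hoppingMatrix_transpose_apply t (insert y (a.erase x)) a]
  exact hoppingMatrix_hop_ne_zero ht hxy.symm hx hy

/-- **Lieb's theorem in the half-filled `S^z = 0` sector, matrix form**: for `t ≠ 0`, `U > 0`, `G`
connected, the lowest eigenvalue of Lieb's operator `W ↦ K_n W + W K_n - U Σ_x L_x W L_x` on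
`n`-subset coefficient matrices is nondegenerate with a positive definite eigenmatrix `W₀`
(conclusion (b) of Theorem 1 applied to the hole–particle transformed problem, as in the proof of
Theorem 2). [cite: LiebPRL1989, proof of Theorem 2] -/
theorem exists_posDef_groundState (hG : G.Connected) {t U : ℝ} (ht : t ≠ 0) (hU : 0 < U) (n : ℕ)
    [Nonempty (Config Λ n)] :
    ∃ W₀ : Matrix (Config Λ n) (Config Λ n) ℂ, W₀.PosDef ∧
      vec W₀ ∈ (Literature.MathematicalPhysics.QuantumLattice.SpinReflection.liebMatrix (liebK G t n) (occInd n) (-U)).groundSpace ∧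
      ∀ v ∈ (Literature.MathematicalPhysics.QuantumLattice.SpinReflection.liebMatrix (liebK G t n) (occInd n) (-U)).groundSpace,
        ∃ c : ℂ, v = c • vec W₀ :=
  Literature.MathematicalPhysics.QuantumLattice.SpinReflection.exists_posDef_groundState_unique ⟨liebK_conjTranspose t n, liebK_transpose G t n⟩
    (neg_lt_zero.2 hU) (fun α β h => occInd_separating n α β h) (liebK_connected G hG ht n)

end SectorGlue

section Reference

variable {Λ : Type*} [LinearOrder Λ] [Fintype Λ]

omit [Fintype Λ] in
/-- The self-sign `π(α) = σ(α, α) = Π_{a ∈ α} jwSign a α = (-1)^{#α choose 2}` of a configuration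
satisfies `π(insert x ρ) = (-1)^{#ρ} π(ρ)` for `x ∉ ρ` (`σ = pairSign`). [folklore] -/
theorem pairSign_self_insert {x : Λ} {ρ : Finset Λ} (hx : x ∉ ρ) :
    pairSign (insert x ρ) (insert x ρ) = (-1) ^ ρ.card * pairSign ρ ρ := by
  unfold pairSign
  rw [Finset.prod_insert hx, jwSign_insert_of_not_lt (lt_irrefl _)]
  have h : ∏ a ∈ ρ, jwSign a (insert x ρ) = (∏ a ∈ ρ, (if x < a then (-1 : ℂ) else 1)) * ∏ a ∈ ρ, jwSign a ρ := by
    rw [← Finset.prod_mul_distrib]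
    exact Finset.prod_congr rfl fun a _ => jwSign_insert hx
  have h2 : (∏ a ∈ ρ, (if x < a then (-1 : ℂ) else 1)) = gtSign x ρ := by
    rw [Finset.prod_ite, Finset.prod_const_one, mul_one, Finset.prod_const, gtSign]
  rw [h, h2, ← mul_assoc, jwSign_mul_gtSign_of_notMem hx]

omit [Fintype Λ] in
/-- `π(α) = σ(α, α)` is invariant under replacing one element: `π((α ∪ y) ∖ x) = π(α)` for `y ∉ α`,
`x ∈ α ∪ y`. [folklore] -/
theorem pairSign_self_flip {α : Finset Λ} {x y : Λ} (hy : y ∉ α) (hx : x ∈ insert y α) :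
    pairSign ((insert y α).erase x) ((insert y α).erase x) = pairSign α α := by
  by_cases hxy : x = y
  · subst hxy; rw [erase_insert hy]
  · have hxα : x ∈ α := (mem_insert.1 hx).resolve_left hxy
    rw [erase_insert_of_ne (Ne.symm hxy), pairSign_self_insert (fun h => hy (mem_of_mem_erase h))]
    conv_rhs => rw [← insert_erase hxα, pairSign_self_insert (Finset.notMem_erase x α)]

/-- **The diagonal sign of Lieb's basis is the Marshall sign**:
`σ(α, αᶜ) κ_A(α) = (-1)^{#(α ∩ A)} π(α)` with `π(α) = σ(α, α)` (`σ = pairSign`); since `π` is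
constant along spin flips (`pairSign_self_flip`), the coefficients of a Fock vector `Φ(D)` with `D`
diagonal carry the Marshall sign `(-1)^{#(up-spins in A)}` relative to `D`. [folklore] -/
theorem pairSign_mul_kappaSign_diag (A α : Finset Λ) :
    pairSign α αᶜ * kappaSign A α = (-1) ^ (α ∩ A).card * pairSign α α := by
  have hk : kappaSign A α = (∏ z ∈ α, memSign A z) * pairSign α α * pairSign α αᶜ := by
    unfold kappaSign pairSign
    rw [← Finset.prod_mul_distrib, ← Finset.prod_mul_distrib]
    refine Finset.prod_congr rfl fun z _ => ?_
    rw [← Finset.union_compl α, jwSign_union disjoint_compl_right]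
    ring
  have hm : (∏ z ∈ α, memSign A z) = (-1) ^ (α ∩ A).card := by
    unfold memSign
    rw [Finset.prod_ite, Finset.prod_const_one, mul_one, Finset.prod_const, Finset.filter_mem_eq_inter]
  have hθ := pairSign_mul_self α αᶜ
  rw [hk, hm]
  linear_combination ((-1 : ℂ) ^ (α ∩ A).card * pairSign α α) * hθ

/-- The reference coefficients `c_p = (n - p)! (J + p)!` (`p` = number of up-spins on `A`): up to
the Marshall sign and normalisation, the Clebsch–Gordan coefficients of the `M = 0` member of the
spin-`J` multiplet obtained by coupling the fully symmetric spins `S_A = |A|/2` and `S_B = |B|/2`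
to the minimal total spin `J = S_B - S_A`. [folklore] -/
def refCoeff (n J p : ℕ) : ℂ := ((Nat.factorial (n - p) * Nat.factorial (J + p) : ℕ) : ℂ)

/-- The reference coefficient matrix: diagonal, `D_αα = c_{#(α ∩ A)}`. [folklore] -/
def refDiag (A : Finset Λ) (n J : ℕ) : Matrix (Config Λ n) (Config Λ n) ℂ :=
  diagonal fun α => refCoeff n J (α.1 ∩ A).card

/-- **The reference state** `Ξ = Φ(D)`: a Fock vector in the half-filled `S^z = 0` sector,
supported on singly occupied configurations `σ_α = α↑ ∪ αᶜ↓`, with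
`Ξ(σ_α) = (Marshall sign) · π(α) · c_{#(α∩A)}`; it has total spin `J` (`spinSq_mulVec_refState`)
and positive Hilbert–Schmidt overlap with every positive definite `W` (`refState_overlap`). It
replaces, in this formalisation, Lieb's continuity-in-`U` appeal to the Heisenberg model and the
Lieb–Mattis theorem for the value of the ground-state spin. [folklore] -/
def refState (A : Finset Λ) (n J : ℕ) : Fock (Orb Λ) := toFockN A n (refDiag A n J)

/-- Values of the reference state: zero off the singly occupied configurations of the sector. [folklore] -/
theorem refState_pairSet (A : Finset Λ) (n J : ℕ) (α γ : Finset Λ) :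
    refState A n J (pairSet α γ) =
      if α.card = n ∧ γ = αᶜ then (-1) ^ (α ∩ A).card * pairSign α α * refCoeff n J (α ∩ A).card else 0 := by
  rw [refState, toFockN, toFock_pairSet]
  by_cases h : α.card = n ∧ γ = αᶜ
  · obtain ⟨hn, rfl⟩ := h
    rw [if_pos ⟨hn, rfl⟩, compl_compl, ← pairSign_mul_kappaSign_diag]
    have hcard : α.card = n ∧ α.card = n := ⟨hn, hn⟩
    have : extMatrix n (refDiag A n J) α α = refCoeff n J (α ∩ A).card := by
      rw [show extMatrix n (refDiag A n J) α α = refDiag A n J ⟨α, hn⟩ ⟨α, hn⟩ from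
        extMatrix_apply_coe n _ ⟨α, hn⟩ ⟨α, hn⟩, refDiag, diagonal_apply_eq]
    rw [this]
  · rw [if_neg h]
    by_cases hc : α.card = n ∧ γᶜ.card = n
    · have hne : (⟨α, hc.1⟩ : Config Λ n) ≠ ⟨γᶜ, hc.2⟩ := by
        intro heq
        apply h ⟨hc.1, _⟩
        have := congrArg Subtype.val heq
        simp only at this
        rw [this, compl_compl]
      rw [show extMatrix n (refDiag A n J) α γᶜ = refDiag A n J ⟨α, hc.1⟩ ⟨γᶜ, hc.2⟩ from
        extMatrix_apply_coe n _ ⟨α, hc.1⟩ ⟨γᶜ, hc.2⟩, refDiag, diagonal_apply_ne _ hne, mul_zero]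
    · rw [extMatrix_apply_of_not n _ hc, mul_zero]

/-- Values of the reference state after one `S⁻S⁺` move inside the singly occupied sector:
the sign is still `(-1)^{p'} π(α)` with the **same** `π(α)`. [folklore] -/
theorem refState_flip (A : Finset Λ) (n J : ℕ) {α : Finset Λ} (hα : α.card = n) {x y : Λ}
    (hy : y ∉ α) (hx : x ∈ insert y α) :
    refState A n J (pairSet ((insert y α).erase x) (insert x (αᶜ.erase y))) =
      (-1) ^ (((insert y α).erase x) ∩ A).card * pairSign α α *
        refCoeff n J (((insert y α).erase x) ∩ A).card := by
  have hc : insert x (αᶜ.erase y) = ((insert y α).erase x)ᶜ := by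
    ext z
    simp only [mem_insert, mem_erase, mem_compl]
    by_cases hzx : z = x
    · simp [hzx]
    · simp only [hzx, false_or, ne_eq, not_false_eq_true, true_and, not_or]
  have hcard : ((insert y α).erase x).card = n := by
    rw [card_erase_of_mem hx, card_insert_of_notMem hy, hα]; rfl
  rw [refState_pairSet, if_pos ⟨hcard, hc⟩, pairSign_self_flip hy hx]

/-- The `S⁻S⁺` double sum in two-species coordinates. [folklore] -/
theorem spinMinus_spinPlus_mulVec_pairSet (ψ : Fock (Orb Λ)) (α γ : Finset Λ) :
    (Literature.MathematicalPhysics.QuantumLattice.spinMinus *ᵥ (spinPlus *ᵥ ψ)) (pairSet α γ) =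
      ∑ y ∈ γ \ α, ∑ x ∈ insert y α \ γ.erase y, ψ (pairSet ((insert y α).erase x) (insert x (γ.erase y))) := by
  rw [spinMinus_mulVec_pairSet]
  refine Finset.sum_congr rfl fun y _ => ?_
  rw [spinPlus_mulVec_pairSet]

/-- `S^z Ξ = 0`: the reference state lies in the `S^z = 0` sector (when `|Λ| = 2n`). [folklore] -/
theorem spinZ_mulVec_refState (A : Finset Λ) {n : ℕ} (hΛ : Fintype.card Λ = 2 * n) (J : ℕ) :
    HubbardWave0.spinZ *ᵥ refState A n J = 0 := by
  funext s
  rw [spinZ_mulVec_apply, Pi.zero_apply]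
  rw [← pairSet_upPart_downPart s, refState_pairSet, upPart_pairSet, downPart_pairSet]
  split_ifs with h
  · rw [h.2, card_compl, hΛ, h.1, Nat.cast_sub (by omega)]
    push_cast; ring
  · rw [mul_zero]

end Reference

section ReferenceSpin

variable {Λ : Type*} [LinearOrder Λ] [Fintype Λ]

omit [LinearOrder Λ] [Fintype Λ] in
/-- A sum over `s` of a function taking one value on `s ∩ A` and another on `s ∖ A`. [folklore] -/
theorem sum_ite_mem_eq [DecidableEq Λ] (s A : Finset Λ) (u v : ℂ) :
    (∑ x ∈ s, if x ∈ A then u else v) = (s ∩ A).card * u + (s \ A).card * v := by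
  rw [Finset.sum_ite, Finset.sum_const, Finset.sum_const, nsmul_eq_mul, nsmul_eq_mul,
    Finset.filter_mem_eq_inter, ← Finset.sdiff_eq_filter]

omit [LinearOrder Λ] in
/-- **The combinatorial heart of `S²Ξ = J(J+1)Ξ`.** For `|Λ| = 2n`, `#α = n`, `#A + J = n` and
coefficients `f` obeying the two contiguity relations of `f p = (-1)^p (n-p)! (J+p)!`, the
`S⁻S⁺` sum over one spin exchange `x ↔ y` (`y ∉ α` flipped up, then `x ∈ α ∪ y` flipped down)
reproduces `J(J+1) f(#(α ∩ A))`: splitting `y ∈ αᶜ` and `x ∈ α` according to the sublattice gives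
`n f_p + (|A|-p)(p f_p + q f_{p+1}) + (J+p)(p f_{p-1} + q f_p) = J(J+1) f_p` (`q = n - p`). [folklore] -/
theorem flip_sum_eq [DecidableEq Λ] (A α : Finset Λ) {n J : ℕ} (hΛ : Fintype.card Λ = 2 * n)
    (hα : α.card = n) (hAJ : A.card + J = n) (f : ℕ → ℂ)
    (hf1 : ∀ p, p < n → ((n - p : ℕ) : ℂ) * f (p + 1) = -(((J + p + 1 : ℕ) : ℂ) * f p))
    (hf2 : ∀ p, 1 ≤ p → p ≤ n → ((J + p : ℕ) : ℂ) * f (p - 1) = -(((n - p + 1 : ℕ) : ℂ) * f p)) :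
    ∑ y ∈ αᶜ, ∑ x ∈ insert y α, f (((insert y α).erase x) ∩ A).card =
      ((J : ℂ) * (J + 1)) * f (α ∩ A).card := by
  -- the four cardinalities
  set p := (α ∩ A).card with hp
  set q := (α \ A).card with hq
  have hpq : p + q = n := by rw [hp, hq, Finset.card_inter_add_card_sdiff, hα]
  have hr : (αᶜ ∩ A).card + (αᶜ \ A).card = n := by
    rw [Finset.card_inter_add_card_sdiff, Finset.card_compl, hΛ, hα]; omega
  have hpr : p + (αᶜ ∩ A).card = A.card := by
    rw [hp, Finset.inter_comm α A, Finset.inter_comm αᶜ A, ← Finset.card_union_of_disjoint]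
    · congr 1; ext z; simp only [mem_union, mem_inter, mem_compl]; tauto
    · rw [Finset.disjoint_left]
      intro z hz hz'
      rw [mem_inter] at hz hz'
      exact (mem_compl.1 hz'.2) hz.2
  -- inner sums
  have hinner : ∀ y ∈ αᶜ, ∑ x ∈ insert y α, f (((insert y α).erase x) ∩ A).card =
      f p + (p * f (p - 1 + if y ∈ A then 1 else 0) + q * f (p + if y ∈ A then 1 else 0)) := by
    intro y hy
    rw [mem_compl] at hy
    rw [Finset.sum_insert hy, erase_insert hy]
    congr 1
    have hx : ∀ x ∈ α, f (((insert y α).erase x) ∩ A).card =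
        if x ∈ A then f (p - 1 + if y ∈ A then 1 else 0) else f (p + if y ∈ A then 1 else 0) := by
      intro x hxα
      have hxy : y ≠ x := fun h => hy (h ▸ hxα)
      rw [erase_insert_of_ne hxy]
      have hcard : ((insert y (α.erase x)) ∩ A).card = ((α.erase x) ∩ A).card + if y ∈ A then 1 else 0 := by
        by_cases hyA : y ∈ A
        · rw [Finset.insert_inter_of_mem hyA, if_pos hyA, card_insert_of_notMem]
          rw [mem_inter, mem_erase]; exact fun h => hy h.1.2
        · rw [Finset.insert_inter_of_notMem hyA, if_neg hyA, add_zero]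
      rw [hcard, Finset.erase_inter]
      by_cases hxA : x ∈ A
      · rw [if_pos hxA, card_erase_of_mem (mem_inter.2 ⟨hxα, hxA⟩)]
      · rw [if_neg hxA, erase_eq_of_notMem (fun h => hxA (mem_inter.1 h).2)]
    rw [Finset.sum_congr rfl hx, sum_ite_mem_eq]
  rw [Finset.sum_congr rfl hinner]
  have houter : (∑ y ∈ αᶜ, (f p + (p * f (p - 1 + if y ∈ A then 1 else 0) + q * f (p + if y ∈ A then 1 else 0)))) =
      ∑ y ∈ αᶜ, (if y ∈ A then f p + (p * f (p - 1 + 1) + q * f (p + 1)) else f p + (p * f (p - 1) + q * f p)) := by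
    refine Finset.sum_congr rfl fun y _ => ?_
    by_cases hyA : y ∈ A <;> simp [hyA]
  rw [houter, sum_ite_mem_eq]
  -- arithmetic
  have hpa : p ≤ A.card := by omega
  have hqc : (q : ℂ) = n - p := by
    have : (p : ℂ) + q = n := by exact_mod_cast hpq
    linear_combination this
  have hr₁c : (((αᶜ ∩ A).card : ℕ) : ℂ) = (n : ℂ) - J - p := by
    have h1 : (p : ℂ) + (αᶜ ∩ A).card = A.card := by exact_mod_cast hpr
    have h2 : (A.card : ℂ) + J = n := by exact_mod_cast hAJ
    linear_combination h1 + h2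
  have hr₂c : (((αᶜ \ A).card : ℕ) : ℂ) = J + p := by
    have : (((αᶜ ∩ A).card : ℕ) : ℂ) + (αᶜ \ A).card = n := by exact_mod_cast hr
    linear_combination this - hr₁c
  rw [hr₁c, hr₂c, hqc]
  rcases Nat.lt_or_ge p n with hpn | hpn
  · -- generic case `p < n`
    have h1 := hf1 p hpn
    simp only [Nat.cast_add, Nat.cast_one, Nat.cast_sub hpn.le] at h1
    rcases Nat.eq_zero_or_pos p with hp0 | hp1
    · -- `p = 0`: the `f (p - 1 + 1)` term has coefficient `p = 0`
      have hp0c : (p : ℂ) = 0 := by exact_mod_cast hp0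
      rw [hp0c] at h1 ⊢
      rw [hp0] at h1 ⊢
      simp only [sub_zero, add_zero, zero_add, zero_mul] at h1 ⊢
      linear_combination ((n : ℂ) - J) * h1
    · have h2 := hf2 p hp1 hpn.le
      simp only [Nat.cast_add, Nat.cast_one, Nat.cast_sub hpn.le] at h2
      rw [Nat.sub_add_cancel hp1]
      linear_combination ((n : ℂ) - J - p) * h1 + (p : ℂ) * h2
  · -- boundary case `p = n` (then `J = 0`, `q = 0`)
    have hpn' : p = n := le_antisymm (by omega) hpn
    have hJ0 : J = 0 := by omega
    rcases Nat.eq_zero_or_pos n with hn0 | hn1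
    · have hp0 : p = 0 := by omega
      have : (p : ℂ) = 0 := by exact_mod_cast hp0
      rw [this, hJ0, hn0]; simp
    · have h2 := hf2 p (by omega) hpn'.le
      rw [hpn', Nat.sub_self, zero_add, Nat.cast_one, one_mul, hJ0, zero_add] at h2
      have hpc : (p : ℂ) = n := by exact_mod_cast hpn'
      rw [hpc, hJ0, hpn']
      simp only [Nat.cast_zero, sub_zero, sub_self, zero_mul, zero_add, add_zero]
      linear_combination (n : ℂ) * h2

/-- Contiguity relation `(n-p) f_{p+1} = -(J+p+1) f_p` of `f_p = (-1)^p (n-p)!(J+p)!`. [folklore] -/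
theorem refCoeff_succ (n J p : ℕ) (hp : p < n) :
    ((n - p : ℕ) : ℂ) * ((-1) ^ (p + 1) * refCoeff n J (p + 1)) =
      -(((J + p + 1 : ℕ) : ℂ) * ((-1) ^ p * refCoeff n J p)) := by
  unfold refCoeff
  have h1 : Nat.factorial (n - p) = (n - p) * Nat.factorial (n - (p + 1)) := by
    rw [show n - p = (n - (p + 1)) + 1 by omega, Nat.factorial_succ]
  have h2 : Nat.factorial (J + (p + 1)) = (J + p + 1) * Nat.factorial (J + p) := by
    rw [show J + (p + 1) = (J + p) + 1 by omega, Nat.factorial_succ]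
  rw [h1, h2]
  push_cast
  ring

/-- Contiguity relation `(J+p) f_{p-1} = -(n-p+1) f_p` of `f_p = (-1)^p (n-p)!(J+p)!`. [folklore] -/
theorem refCoeff_pred (n J p : ℕ) (hp1 : 1 ≤ p) (hpn : p ≤ n) :
    ((J + p : ℕ) : ℂ) * ((-1) ^ (p - 1) * refCoeff n J (p - 1)) =
      -(((n - p + 1 : ℕ) : ℂ) * ((-1) ^ p * refCoeff n J p)) := by
  unfold refCoeff
  have h1 : Nat.factorial (n - (p - 1)) = (n - p + 1) * Nat.factorial (n - p) := by
    rw [show n - (p - 1) = (n - p) + 1 by omega, Nat.factorial_succ]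
  have h2 : Nat.factorial (J + p) = (J + p) * Nat.factorial (J + (p - 1)) := by
    rw [show J + p = (J + (p - 1)) + 1 by omega, Nat.factorial_succ]
  have h3 : ((-1 : ℂ)) ^ p = -((-1) ^ (p - 1)) := by
    rw [show p = (p - 1) + 1 by omega, pow_succ]; simp
  rw [h1, h2, h3]
  push_cast
  ring

/-- `S² = S⁻S⁺` on `S^z = 0` vectors. [folklore] -/
theorem spinSq_mulVec_eq_of_spinZ_zero {ψ : Fock (Orb Λ)} (hψ : HubbardWave0.spinZ *ᵥ ψ = 0) :
    spinSq *ᵥ ψ = Literature.MathematicalPhysics.QuantumLattice.spinMinus *ᵥ (spinPlus *ᵥ ψ) := by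
  show spinSq *ᵥ ψ = spinPlusᴴ *ᵥ (spinPlus *ᵥ ψ)
  have hcomm : (spinPlus * spinPlusᴴ : Matrix (Finset (Orb Λ)) _ ℂ) = spinPlusᴴ * spinPlus + (2 : ℂ) • HubbardWave0.spinZ := by
    have h := spinPlus_mul_spinMinus_sub (Λ := Λ)
    simp only [Literature.MathematicalPhysics.QuantumLattice.spinMinus] at h
    rw [← h]; abel
  rw [spinSq, add_mulVec, smul_mulVec, add_mulVec, hcomm, add_mulVec, smul_mulVec, ← mulVec_mulVec,
    ← mulVec_mulVec, hψ, mulVec_zero, smul_zero, zero_add, add_zero, ← two_smul ℂ, smul_smul]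
  norm_num

/-- **The reference state has total spin `J`**: `S² Ξ = J(J+1) Ξ` for `|Λ| = 2n`, `|A| + J = n`
(i.e. `J = (|B| - |A|)/2`). [folklore] -/
theorem spinSq_mulVec_refState (A : Finset Λ) {n J : ℕ} (hΛ : Fintype.card Λ = 2 * n)
    (hAJ : A.card + J = n) :
    spinSq *ᵥ refState A n J = ((J : ℂ) * (J + 1)) • refState A n J := by
  rw [spinSq_mulVec_eq_of_spinZ_zero (spinZ_mulVec_refState A hΛ J)]
  funext s
  rw [← pairSet_upPart_downPart s, Pi.smul_apply, spinMinus_spinPlus_mulVec_pairSet, refState_pairSet, smul_eq_mul]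
  set α := upPart s
  set γ := downPart s
  by_cases h : α.card = n ∧ γ = αᶜ
  · obtain ⟨hα, hγ⟩ := h
    rw [if_pos ⟨hα, hγ⟩, hγ, sdiff_eq_self_of_disjoint disjoint_compl_left]
    have hidx : ∀ y ∈ αᶜ, insert y α \ αᶜ.erase y = insert y α := by
      intro y hy
      ext z
      simp only [mem_sdiff, mem_insert, mem_erase, mem_compl, not_and, not_not]
      constructor
      · exact fun h => h.1
      · intro hz
        refine ⟨hz, fun hzy => ?_⟩
        rcases hz with h | h
        · exact absurd h hzy
        · exact h
    rw [Finset.sum_congr rfl fun y hy => by rw [hidx y hy]]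
    have hterm : ∀ y ∈ αᶜ, ∀ x ∈ insert y α,
        refState A n J (pairSet ((insert y α).erase x) (insert x (αᶜ.erase y))) =
          pairSign α α * ((-1) ^ (((insert y α).erase x) ∩ A).card * refCoeff n J (((insert y α).erase x) ∩ A).card) := by
      intro y hy x hx
      rw [refState_flip A n J hα (mem_compl.1 hy) hx]; ring
    rw [Finset.sum_congr rfl fun y hy => Finset.sum_congr rfl fun x hx => hterm y hy x hx]
    simp_rw [← Finset.mul_sum]
    rw [flip_sum_eq A α hΛ hα hAJ (fun k => (-1) ^ k * refCoeff n J k)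
      (fun p hp => refCoeff_succ n J p hp) (fun p hp1 hpn => refCoeff_pred n J p hp1 hpn)]
    ring
  · rw [if_neg h, mul_zero]
    refine Finset.sum_eq_zero fun y hy => Finset.sum_eq_zero fun x hx => ?_
    rw [refState_pairSet, if_neg]
    rintro ⟨hcard, hcompl⟩
    rw [mem_sdiff] at hy
    rw [mem_sdiff, mem_erase, not_and, not_imp_not] at hx
    have hyx : ∀ {z}, z ∈ insert y α → z ∉ γ.erase y → True := fun _ _ => trivial
    apply h
    constructor
    · rw [card_erase_of_mem hx.1, card_insert_of_notMem hy.2] at hcard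
      simpa using hcard
    · ext z
      have hz := Finset.ext_iff.1 hcompl z
      simp only [mem_insert, mem_erase, mem_compl, not_and] at hz
      rw [mem_compl]
      by_cases hzx : z = x
      · subst hzx
        by_cases hzy : z = y
        · subst hzy; exact ⟨fun _ => hy.2, fun _ => hy.1⟩
        · have hzα : z ∈ α := (mem_insert.1 hx.1).resolve_left hzy
          constructor
          · intro hzγ; exact absurd (hx.2 hzγ) hzy
          · intro hzα'; exact absurd hzα hzα'
      · by_cases hzy : z = y
        · subst hzy; exact ⟨fun _ => hy.2, fun _ => hy.1⟩
        · constructor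
          · intro hzγ
            have := hz.1 (Or.inr ⟨hzy, hzγ⟩)
            exact fun hzα => (this hzx) (Or.inr hzα)
          · intro hzα
            have := hz.2 (fun _ h => h.elim hzy hzα)
            rcases this with h1 | h1
            · exact absurd h1 hzx
            · exact h1.2

/-- **Overlap of the reference state with Lieb's states**: `⟨Ξ, Φ(W)⟩ = Σ_α c_{#(α∩A)} W_αα`
(unitarity of `Φ` and `Ξ = Φ(D)` with `D` diagonal). [folklore] -/
theorem refState_overlap (A : Finset Λ) (n J : ℕ) (W : Matrix (Config Λ n) (Config Λ n) ℂ) :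
    star (refState A n J) ⬝ᵥ toFockN A n W = ∑ α : Config Λ n, refCoeff n J (α.1 ∩ A).card * W α α := by
  rw [refState, star_toFockN_dotProduct_toFockN, hsInner_apply]
  refine Finset.sum_congr rfl fun α _ => ?_
  simp only [refDiag]
  rw [Finset.sum_eq_single α]
  · rw [diagonal_apply_eq, refCoeff]; simp
  · intro β _ hβ; rw [diagonal_apply_ne _ (Ne.symm hβ), star_zero, zero_mul]
  · simp

/-- The overlap with a positive definite `W` is nonzero ("`W ≥ 0` implies `W_αα > 0` …", Lieb's
overlap argument of Theorem 1(a), here with the spin-`J` reference state). [cite: LiebPRL1989, proof of Theorem 1] -/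
theorem refState_overlap_ne_zero (A : Finset Λ) (n J : ℕ) [Nonempty (Config Λ n)]
    {W : Matrix (Config Λ n) (Config Λ n) ℂ} (hW : W.PosDef) :
    star (refState A n J) ⬝ᵥ toFockN A n W ≠ 0 := by
  rw [refState_overlap]
  have hpos : 0 < ∑ α : Config Λ n, refCoeff n J (α.1 ∩ A).card * W α α := by
    apply Finset.sum_pos _ Finset.univ_nonempty
    intro α _
    refine mul_pos ?_ hW.diag_pos
    unfold refCoeff
    exact_mod_cast Nat.mul_pos (Nat.factorial_pos _) (Nat.factorial_pos _)
  exact hpos.ne'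

end ReferenceSpin

end Literature.MathematicalPhysics.QuantumLattice.LiebTwo
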